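import Summits.Langlands.Langlands.Theses.DyadicOddResidue
import Summits.Langlands.Langlands.Theorems.DyadicOddResidueOddPrimesRegularFM
import Literature.NumberTheory.Automorphic.FontaineMazurGL2OddPrime
import Literature.NumberTheory.GaloisRepresentations.OrdinaryTwistedDeterminant
import Literature.NumberTheory.GaloisRepresentations.CyclotomicCharacterFrobeniusProofs
import Literature.NumberTheory.Automorphic.AlgebraicityParityGL
import HarnessLib

/-!
# `DyadicOddResidue.DyadicDihedralFM` (item stmt-Langlands-18742), line `Sketch`, stub `stub_dictionary`:
# the newform → `L`-algebraic `π` dictionary with a Tate twist absorbed, at EVERY prime `ℓ`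

The line `Sketch` for the crux `DyadicDihedralFM` (Fontaine–Mazur for `GL₂/ℚ` at `ℓ = 2` in the
residually dihedral case) factors as (pro-modularity) → (classicality: some Tate twist
`ρ ⊗ ε_ℓ^m` is the Galois representation of a newform `f`, classical rendering
`IsGaloisRepOfNewform1 f ι_f {q ∣ N ℓ} (ρ ⊗ χ)`) → (dictionary).  This file proves the dictionary
stub, for every prime `ℓ` and every single `ρ`: if some Tate twist `ρ ⊗ χ`, `χ = ε_ℓ^m`, is
attached to a newform `f ∈ S_k(Γ₁(N))` along `ι_f : K_f → ℚ̄_ℓ` away from `N ℓ`, then for every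
`hcpt` and every `ι : ℚ̄_ℓ ≃ ℂ` there is an `L`-algebraic cuspidal `π` of `GL₂(𝔸_ℚ)` which is
Satake–Frobenius compatible with `ρ` at almost every finite place.

The proof is the argument of
`Summit.Langlands.Langlands.Theorems.oddPrimesRegularFM_of_tateTwistModularity`
(file `DyadicOddResidueOddPrimesRegularFM.lean`, which never uses `ℓ` odd), with `ℓ` free:
`τ = ι ∘ ι_f`; the conjugate newform `f^τ` gives an `L`-algebraic cuspidal `π₂` with Satake
parameters `{β₁⁻¹, β₂⁻¹}` at almost every `q`, `τ(H_q(f)) = (X - β₁)(X - β₂)`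
(`exists_isLAlgebraic_hasSatakeParamAt_rootsInv_of_isNewform1`); `π = π₂ ⊗ |det|^{-m}` is
cuspidal and `L`-algebraic with Satake parameters `q^m {β_j⁻¹}`
(`HasSatakeParamAt.of_map_mulChar_detTwist_of_cpow`); `ρ = (ρ ⊗ ε^m) ⊗ ε^{-m}` is unramified at
`q ∤ N ℓ` (`cyclotomicPadicAlgCl_eq_one_of_mem_inertia`) with
`charpoly ρ(Frob_q) = X² - q^{-m} ι_f(a_q) X + q^{-2m} ι_f(ε_f(q) q^{k-1})`
(`charpoly_eq_of_charpoly_twist_eq`, `coe_cyclotomicPadicAlgCl_of_isArithFrobAt`), which is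
`arithFrobPolyOfSatake ι q 1 (q^m {β_j⁻¹})` (`arithFrobPolyOfSatake_one_rootsInv_smul`).
Sorry-free; axioms `propext`, `Classical.choice`, `Quot.sound`.
-/

noncomputable section

open scoped MatrixGroups ModularForm Classical Polynomial NumberField
open NumberField IsDedekindDomain Filter Polynomial CongruenceSubgroup Field
open Literature.NumberTheory.Automorphic Literature.NumberTheory.EllipticCurves.ModularForms
  Literature.NumberTheory.GaloisRepresentations
open Summit.Langlands.Langlands.Cruxes.SerreKWAutomorphicGL2.AdelicNewformDatumDoubleTwist

namespace Summit.Langlands.Langlands.Theorems.DyadicDihedralFM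

set_option linter.dupNamespace false -- project-wide option; `Summit.Langlands.Langlands` is the mandated namespace

open Rat.HeightOneSpectrum
open Summit.Langlands.Langlands.Theorems

/-- **Dictionary stub of the line `Sketch` for `DyadicDihedralFM`: Tate-twist newform modularity ⇒
the crux's automorphic conclusion, at every prime `ℓ`.**  For a prime `ℓ` and a continuous
`ρ : Γ_ℚ → GL₂(ℚ̄_ℓ)`, if there are a continuous character `χ = ε_ℓ^m` (`m ∈ ℤ`), a newform
`f ∈ S_k(Γ₁(N))` and `ι_f : K_f → ℚ̄_ℓ` with `ρ ⊗ χ` attached to `f` away from `N ℓ`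
(`IsGaloisRepOfNewform1`), then for every `hcpt` and `ι : ℚ̄_ℓ ≃ ℂ` the `L`-algebraic cuspidal
`π = π₂(f^τ) ⊗ |det|^{-m}` (`τ = ι ∘ ι_f`) is Satake–Frobenius compatible with `ρ` at every
`v = q ∤ N ℓ` outside the finite exceptional set of `π₂`: `π` has Satake parameter
`q^m {β₁⁻¹, β₂⁻¹}`, `ρ` is unramified at `v`, and
`charpoly ρ(Frob_v) = X² - q^{-m} ι_f(a_q) X + q^{-2m} ι_f(ε_f(q) q^{k-1})
= arithFrobPolyOfSatake ι q 1 (q^m {β_j⁻¹})`.  The argument of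
`oddPrimesRegularFM_of_tateTwistModularity` with `ℓ` free.
[cite: BuzzardGeeLMS2014, Conj. 3.2.2 and Rem. 3.2.5] [cite: Gelbart1975, §3 Lemma 3.7 and Thm. 5.19]
[cite: SerreAbelianLadic1968, Ch. I §1.2 (Example: the cyclotomic character)] -/
theorem stub_dictionary : ∀ (ℓ : ℕ) [Fact ℓ.Prime] (ρ : Literature.NumberTheory.GaloisRepresentations.FramedGaloisRep ℚ (PadicAlgCl ℓ) 2), (∃ (χ : Field.absoluteGaloisGroup ℚ →ₜ* (PadicAlgCl ℓ)ˣ) (m : ℤ), (∀ σ, χ σ = Literature.NumberTheory.GaloisRepresentations.cyclotomicPadicAlgCl ℚ ℓ σ ^ m) ∧ ∃ (N : ℕ) (_ : NeZero N) (k : ℤ) (f : CuspForm (CongruenceSubgroup.Gamma1 N) k) (ιf : Literature.NumberTheory.EllipticCurves.ModularForms.coeffCharField f →+* PadicAlgCl ℓ), Literature.NumberTheory.EllipticCurves.ModularForms.IsNewform1 f ∧ Literature.NumberTheory.EllipticCurves.ModularForms.IsGaloisRepOfNewform1 f ιf {q | q ∣ N * ℓ} (Literature.NumberTheory.GaloisRepresentations.FramedRep.twist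 ρ χ)) → ∀ (hcpt : Literature.NumberTheory.Automorphic.isCompact_glFiniteIntegralLevel 2 ℚ) (ι : PadicAlgCl ℓ ≃+* ℂ), ∃ π : Literature.NumberTheory.Automorphic.CuspidalAutomorphicRepData 2 ℚ hcpt, π.1.IsLAlgebraic ∧ ∀ᶠ v : IsDedekindDomain.HeightOneSpectrum (NumberField.RingOfIntegers ℚ) in Filter.cofinite, Summit.Langlands.SatakeFrobCompatibleAt ι π.1 ρ v := by
  intro ℓ _ ρ hH hcpt ι
  have hℓp : ℓ.Prime := Fact.out
  obtain ⟨χ, m, hχ, N, _, k, f, ιf, hf, hρ'⟩ := hH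
  -- the automorphic side: `π₂ = π(f^τ)` (L-normalised) and its norm twist `π = π₂ ⊗ |det|^{-m}`
  set τ : coeffCharField f →+* ℂ := (ι : PadicAlgCl ℓ →+* ℂ).comp ιf with hτdef
  obtain ⟨π₂, ⟨T, hT, hTL⟩, hsat₂⟩ :=
    exists_isLAlgebraic_hasSatakeParamAt_rootsInv_of_isNewform1 hf τ hcpt
  obtain ⟨ψ, π, hψ, hW, hW', hTπ⟩ :=
    CuspidalAutomorphicRepData.exists_twist_hasInfinityType π₂ (((-m : ℤ) : ℝ)) hT
  refine ⟨π, ⟨_, hTπ, ?_⟩, ?_⟩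
  · rw [Complex.ofReal_intCast]
    exact (InfinityType.isLAlgebraic_twist_intCast_iff T (-m)).2 hTL
  have hgood := eventually_not_dvd (n := N * ℓ) (mul_ne_zero (NeZero.ne N) hℓp.ne_zero)
  filter_upwards [hsat₂, hgood] with v hv₂ hvNℓ
  -- notation at the good place `v`: `q = p_v`, `q ∤ N ℓ`
  have hq : ((Rat.HeightOneSpectrum.primesEquiv v : Nat.Primes) : ℕ) = natGenerator v := rfl
  have hℓv : (ℓ : 𝓞 ℚ) ∉ v.asIdeal := fun h =>
    hvNℓ (hq ▸ Dvd.dvd.mul_left ((Rat.natCast_mem_asIdeal_iff v).1 h) N)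
  obtain ⟨hunr', hfrob'⟩ := hρ' v hvNℓ
  have hsatπ := AutomorphicRepData.HasSatakeParamAt.of_map_mulChar_detTwist_of_cpow hψ hW hW' hv₂
  refine ⟨_, hsatπ, ?_, ?_⟩
  · -- `ρ` is unramified at `v`: `ρ ⊗ ε^m` is, and `ε` is
    intro 𝔓 h𝔓 σ hσ
    refine apply_eq_one_of_twist_apply_eq_one ρ χ ?_ (hunr' 𝔓 h𝔓 σ hσ)
    rw [hχ, cyclotomicPadicAlgCl_eq_one_of_mem_inertia ℓ hℓv h𝔓 hσ, one_zpow]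
  · -- the Frobenius polynomial
    intro 𝔓 h𝔓 σ hσ
    have h2 := hfrob' 𝔓 h𝔓 σ hσ
    -- the Hecke polynomial of `f` at `q`, along `ι_f` and along `τ = ι ∘ ι_f`
    set aK : coeffCharField f := ⟨(UpperHalfPlane.qExpansion 1 ⇑f).coeff (natGenerator v),
      cuspCoeff_mem_coeffCharField f _⟩ with haK
    set bK : coeffCharField f := ⟨(nebentypus f ((natGenerator v : ℕ) : ZMod N) : ℂ) *
        ((natGenerator v : ℕ) : ℂ) ^ (k - 1), nebentypus_mul_zpow_mem_coeffCharField f _⟩ with hbK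
    have hH : heckePolynomial f (natGenerator v) = X ^ 2 - C aK * X + C bK := rfl
    rw [hq, hH, Polynomial.map_add, Polynomial.map_sub, Polynomial.map_mul, Polynomial.map_pow,
      map_X, map_C, map_C] at h2
    have hρσ := charpoly_eq_of_charpoly_twist_eq ρ χ σ h2
    -- `χ(σ) = ε(σ)^m = q^m`
    have hc : ((χ σ : (PadicAlgCl ℓ)ˣ) : PadicAlgCl ℓ) = ((natGenerator v : ℕ) : PadicAlgCl ℓ) ^ m := by
      rw [hχ, Units.val_zpow_eq_zpow_val, coe_cyclotomicPadicAlgCl_of_isArithFrobAt ℓ hℓv h𝔓 hσ,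
        Rat.residueCard_eq_natGenerator]
    rw [hρσ, hq, hH, Polynomial.map_add, Polynomial.map_sub, Polynomial.map_mul, Polynomial.map_pow,
      map_X, map_C, map_C, arithFrobPolyOfSatake_one_rootsInv_smul]
    -- compare coefficients: `ι⁻¹(w⁻¹) = q^{-m} = χ(σ)⁻¹`, `ι⁻¹ ∘ τ = ι_f`
    have hw : ι.symm ((v.residueCard : ℂ) ^ (-((((-m : ℤ) : ℝ)) : ℂ)))⁻¹ =
        (((natGenerator v : ℕ) : PadicAlgCl ℓ) ^ m)⁻¹ := by
      rw [Rat.residueCard_eq_natGenerator, Complex.ofReal_intCast, ← Int.cast_neg, neg_neg,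
        Complex.cpow_intCast, map_inv₀, map_zpow₀, map_natCast]
    have hτ : ∀ x : coeffCharField f, ι.symm (τ x) = ιf x := fun x => by
      rw [hτdef, RingHom.comp_apply]
      exact ι.symm_apply_apply _
    rw [hw, hτ, hτ, hc]

end Summit.Langlands.Langlands.Theorems.DyadicDihedralFM

end
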